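/-
Copyright (c) 2026 the pub-hodgecm-mathlib formalisation cell (harness21).  Prover seat hodgecm-mathlib-K2E1-p09 (g6), Track B ∕ K2-LIT, h413 =
`stmt-HodgeConjecture-24833`, ENGINE E1, campaign «EIS-WHITTAKER-3», deal D-W5 «W2₃-fin-S» of the dealer K2E1-plan (g5) (DEALS MEMO fe56b7cd5d935977 §D-W5; ruling «=» AS TYPED
2026-09-04T08:41:11Z: «FILE A now (split §5 to `…U3Tail` if > 400 l.)»).  FILE A-TAIL = §5 of the REPORT-FIRST heads 08:40:13Z.
-/
import Summits.HodgeConjecture.HodgeConjecture.Theorems.K2E1FiniteWhittakerStepSymbolU3   -- ★ FILE A (this seat): radial step kernels, shell sum, `shellSum_add_const`, `differentiable_shellSum`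
import Literature.Analysis.Complex.HolomorphicParametricIntegral                          -- ★ `differentiableOn_integral_of_dominated` (holomorphy of dominated parameter integrals)
import HarnessLib

/-!
# K2·E1 — `K2E1FiniteWhittakerStepSymbolU3Tail` (D-W5 «W2₃-fin-S», FILE A-TAIL): TWO-VARIABLE KERNELS `Ψ_z(X) = ∫_T h(X,t)^{−z} dν` — ENTIRE BOUNDED-`t` INTEGRALS, THE TAIL
# SPLIT, AND THE HEAD «THE WHITTAKER `S`-FACTOR OF `U(2,1)` IS ONE ENTIRE FUNCTION ALTHOUGH NO SINGLE SHELL VALUE IS»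

Track B ∕ K2-LIT, crux h413 = `stmt-HodgeConjecture-24833`, route of record `HCCMUnconditional`; cell `hodgecm-mathlib`, squad K2, ENGINE E1 (campaign «EIS-WHITTAKER-3», spec
of record = K2E1b-plan (g6) CENSUS ba907189b20ed180 §2 «Bad places», W0₃ CONVENTIONS 2fdd2f7063acaab9 §4 (iii)); dealer K2E1-plan (g5) «=» 08:41:11Z.  Prover seat
`hodgecm-mathlib-K2E1-p09` (g6).  THEOREMS ONLY (no `def`, no `instance`, no notation, no named-fact hypothesis, no `sorry`; default heartbeats); lane
`--supports stmt-HodgeConjecture-24833 --as helper` (count-neutral).  Closes no socket.  CURRENCY = ★ FILE A's (`K` a non-archimedean local field, Haar `μ`, `ψ` continuous of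
conductor exponent `m`, balls `𝔭^j = primePowBall K j`) plus ANY measure space `(T, ν)` for the centre variable (`= (L⁺_v, ν_v)`).

THE MATHEMATICS [Tate1950, §2.5; JacquetLanglands1970, §3; Casselman1980, §3].  At a bad finite place `v ∈ S` the abelian Whittaker local factor of the spherical section of
`U(2,1)_{L∕L⁺}` is `W_v(ξ, z) = ∫_{L_w} Ψ_z(X) ψ_w(Xξ) dX` with the TWO-VARIABLE KERNEL `Ψ_z(X) = ∫_{L⁺_v} h(X,t)^{−z} dt`, `h ≥ 1` (★ (a2)₃ :321).  By ★ FILE A, if `Ψ_z` is a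
radial step kernel (base value `c₀(z) = ∫ h(0,t)^{−z}`, shell values `c_k(z) = ∫ h(x_k,t)^{−z}`) then `W_v(ξ, z)` is the FINITE SHELL SUM `S(c₀(z), c(z); n)` (`n` the
conductor-shifted order of `ξ`).  No single `c_k` is entire (the `t`-tail `∫_{‖tδ‖ > τ} ‖tδ‖^{−z} dt = Σ_j q^{j(1−2z)}·(…)` has poles on `Re z = ½`), but under the TAIL LETTER
`h(x_k, t) = h(0, t)` for `t ∉ S_τ` (`k ≤ n`; at the instance: `‖tδ − ½N(X)‖ = ‖tδ‖` once `‖tδ‖ > max(1, ‖X‖, ‖½N(X)‖)`, ultrametric) each shell value SPLITS as `c_k = Φ_k + g`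
with the bounded-`t` integral `Φ_k(z) = ∫_{S_τ} h(x_k,t)^{−z} dν` — ENTIRE (dominated holomorphy: `1 ≤ h ≤ H` on a finite-measure set) — and the COMMON tail `g(z) = ∫_{S_τᶜ}
h(0,t)^{−z} dν`; since the shell-sum coefficients add to ZERO (★ FILE A `shellSum_add_const`), `S(c₀, c; n) = S(Φ₀, Φ; n)` =: `W(z)` is ENTIRE.  So: THE `S`-FACTOR AGREES,
WHEREVER ITS ITERATED INTEGRAND IS INTEGRABLE (the consumer's Euler-product letter, `1 < Re z`), WITH ONE ENTIRE FUNCTION; it VANISHES for `ξ ∉ 𝔭^{m−a}` (support = a fractional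
ideal, the `Cf`-box of W4₃); and ★ FILE A §3 bounds it (trivial bound uniform in `ξ`; linear in `n` under the decay letter).  The letters (B) base ball, (R) radial shells, (T) tail,
(H) boundedness are ultrametric∕substitution facts of the instance `h = max(1, ‖X‖, ‖tδ − ½X·σX‖)` — FILE B `K2E1FiniteWhittakerStepSymbolU3Line`.

* §5a **`differentiable_setIntegral_cpow_neg_of_bounded`** — `z ↦ ∫_S g(t)^{−z} dν` is ENTIRE for `g` measurable, `1 ≤ g ≤ H` on `S`, `ν(S) < ∞` (★ `differentiableOn_integral_of_dominated`).
* §5b `integral_cpow_neg_eq_setIntegral_add_tail` — the tail split `∫_T g^{−z} = ∫_S g^{−z} + ∫_{Sᶜ} g₀^{−z}` under `g = g₀` off `S`.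
* §5c **`integral_integral_cpow_neg_mul_addChar_eq_shellSum`** — `∫_K (∫_T h(X,t)^{−z} dν) ψ(Xξ) dμ = S(Φ₀(z), Φ(z); n)` (tail cancelled);
  **`exists_entire_eq_integral_integral_cpow_neg_mul_addChar`** (HEAD) — `∃ W` ENTIRE agreeing with the `S`-factor at every `z` of integrability;
  `integral_integral_cpow_neg_mul_addChar_eq_zero_of_not_mem` — vanishing below the threshold `𝔭^{m−a}`.
HONEST LABEL: HC_CM is proved only modulo the 7 printed citations (2 remaining named inputs: hLiu418 = `stmt-HodgeConjecture-24832`, h413 = `stmt-HodgeConjecture-24833`) until rung 0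
closes; this file asserts no named fact and closes no socket; count-neutral.

## References
* [Tate1950] J. Tate, *Fourier analysis in number fields and Hecke's zeta-functions* (1950), §2.5, in Cassels–Fröhlich (1967) Ch. XV.
* [JacquetLanglands1970] H. Jacquet, R. P. Langlands, *Automorphic Forms on GL(2)*, LNM 114 (1970), §3 (Whittaker functions at ramified places are finite shell sums).
* [Casselman1980] W. Casselman, *The unramified principal series of p-adic groups I*, Compositio Math. 40 (1980), §3.
-/

set_option autoImplicit false
set_option linter.dupNamespace false  -- the mandated namespace repeats the summit's segment (`HodgeConjecture.HodgeConjecture`)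

noncomputable section

open MeasureTheory Filter Topology Set
open scoped NNReal ENNReal
open Literature.NumberTheory.GaloisRepresentations.IsNonarchimedeanLocalField
open Literature.NumberTheory.Automorphic Literature.NumberTheory.Automorphic.LocalFieldHaar
open Summit.HodgeConjecture.HodgeConjecture.Cruxes.H413.K2E1FiniteWhittakerStepSymbolU3

namespace Summit.HodgeConjecture.HodgeConjecture.Cruxes.H413.K2E1FiniteWhittakerStepSymbolU3Tail

variable {K : Type*} [Field K] [ValuativeRel K] [TopologicalSpace K] [IsNonarchimedeanLocalField K]
variable [MeasurableSpace K] [BorelSpace K] (μ : Measure K) [μ.IsAddHaarMeasure]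

/-! ## §5 Two-variable kernels: entire bounded-`t` integrals, the tail split, the entire `S`-factor -/

section TwoVariable

variable {T : Type*} [MeasurableSpace T] (ν : Measure T)

/-- **A BOUNDED-`t` INTEGRAL IS ENTIRE**: for `g` measurable with `1 ≤ g ≤ H` on a measurable set `S` of finite measure, `z ↦ ∫_S g(t)^{−z} dν(t)` is entire (dominated holomorphy ★
`Literature.Analysis.Complex.differentiableOn_integral_of_dominated`: on `ball z₀ 1`, `‖g^{−z}‖ = g^{−Re z} ≤ max(1,H)^{|Re z₀|+1}`, an integrable constant). [folklore] -/
theorem differentiable_setIntegral_cpow_neg_of_bounded {S : Set T} (hSm : MeasurableSet S) (hS : ν S ≠ ∞) {g : T → ℝ} (hg : Measurable g) (hg1 : ∀ t ∈ S, 1 ≤ g t)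
    {H : ℝ} (hgH : ∀ t ∈ S, g t ≤ H) :
    Differentiable ℂ fun z : ℂ => ∫ t in S, ((g t : ℝ) : ℂ) ^ (-z) ∂ν := by
  haveI : IsFiniteMeasure (ν.restrict S) := isFiniteMeasure_restrict.2 hS
  refine differentiableOn_univ.1 (Literature.Analysis.Complex.differentiableOn_integral_of_dominated (U := Set.univ) (μ := ν.restrict S)
    (F := fun (z : ℂ) (t : T) => ((g t : ℝ) : ℂ) ^ (-z)) (fun z _ => ?_) ?_ (fun z₀ _ => ?_))
  · exact ((Complex.measurable_ofReal.comp hg).pow_const (-z)).aestronglyMeasurable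
  · filter_upwards [ae_restrict_mem hSm] with t ht
    exact (differentiable_id.neg.const_cpow (Or.inl (Complex.ofReal_ne_zero.2 (by linarith [hg1 t ht])))).differentiableOn
  · refine ⟨1, one_pos, Set.subset_univ _, fun _ => (max 1 H) ^ (|z₀.re| + 1), integrable_const _, ?_⟩
    filter_upwards [ae_restrict_mem hSm] with t ht z hz
    have hgt : 0 < g t := by linarith [hg1 t ht]
    have h2 : |(z - z₀).re| ≤ ‖z - z₀‖ := Complex.abs_re_le_norm (z - z₀)
    rw [Complex.sub_re] at h2
    have h1 : ‖z - z₀‖ < 1 := mem_ball_iff_norm.1 hz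
    have hz' : -z.re ≤ |z₀.re| + 1 := by
      have := (abs_le.1 h2).1
      linarith [neg_abs_le z₀.re]
    rw [Complex.norm_cpow_eq_rpow_re_of_pos hgt, Complex.neg_re]
    calc (g t) ^ (-z.re) ≤ (g t) ^ (|z₀.re| + 1) := Real.rpow_le_rpow_of_exponent_le (hg1 t ht) hz'
      _ ≤ (max 1 H) ^ (|z₀.re| + 1) := Real.rpow_le_rpow hgt.le ((hgH t ht).trans (le_max_right _ _)) (by positivity)

/-- **THE TAIL SPLIT**: if `g = g₀` off a measurable set `S` (the tail letter) and `g^{−z}` is integrable, then `∫_T g^{−z} dν = ∫_S g^{−z} dν + ∫_{Sᶜ} g₀^{−z} dν` — the shell value is a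
bounded-`t` integral plus a tail COMMON to all shells. [folklore] -/
theorem integral_cpow_neg_eq_setIntegral_add_tail {S : Set T} (hSm : MeasurableSet S) {g g₀ : T → ℝ} (htail : ∀ t ∉ S, g t = g₀ t) {z : ℂ}
    (hint : Integrable (fun t => ((g t : ℝ) : ℂ) ^ (-z)) ν) :
    ∫ t, ((g t : ℝ) : ℂ) ^ (-z) ∂ν = (∫ t in S, ((g t : ℝ) : ℂ) ^ (-z) ∂ν) + ∫ t in Sᶜ, ((g₀ t : ℝ) : ℂ) ^ (-z) ∂ν := by
  rw [← integral_add_compl hSm hint]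
  congr 1
  exact setIntegral_congr_fun hSm.compl fun t ht => by rw [htail t ht]

/-- **THE `S`-FACTOR OF A TWO-VARIABLE KERNEL IS A SHELL SUM OF BOUNDED-`t` INTEGRALS.**  Letters: (B) base ball `h(X,·) = h(0,·)` for `X ∈ 𝔭^a`; (R) on the shell `k` the `t`-integral
of `h(X,·)^{−z}` is that of `h(x_k,·)^{−z}`; (T) tail `h(x_k,·) = h(0,·)` off a measurable `S ⊆ T` for `k ≤ n`; integrability of the iterated integrand on `K` and of the `n+2` shell
integrands on `T`.  Then for `ξ ∈ 𝔭^{m−a+n} ∖ 𝔭^{m−a+n+1}`: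
`∫_K (∫_T h(X,t)^{−z} dν) ψ(Xξ) dμ = Φ₀ μ(𝔭^a) + Σ_{k<n} Φ_k (μ(𝔭^{a−k−1}) − μ(𝔭^{a−k})) − Φ_n μ(𝔭^{a−n})`, `Φ_k = ∫_S h(x_k,t)^{−z} dν`, `Φ₀ = ∫_S h(0,t)^{−z} dν` — the common tail
`∫_{Sᶜ} h(0,t)^{−z} dν` has CANCELLED (§3). [cite: Tate1950, §2.5] [cite: JacquetLanglands1970, §3] -/
theorem integral_integral_cpow_neg_mul_addChar_eq_shellSum {h : K → T → ℝ} {a : ℤ} (hB : ∀ X ∈ primePowBall K a, ∀ t, h X t = h 0 t) {x : ℕ → K} {z : ℂ}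
    (hR : ∀ k : ℕ, ∀ X ∈ primePowBall K (a - ((k : ℤ) + 1)) \ primePowBall K (a - (k : ℤ)),
      ∫ t, ((h X t : ℝ) : ℂ) ^ (-z) ∂ν = ∫ t, ((h (x k) t : ℝ) : ℂ) ^ (-z) ∂ν)
    {ψ : AddChar K Circle} (hψ : Continuous ψ) {m : ℤ} (hm : ψ.HasConductorExp m) {ξ : K} {n : ℕ} (hn : ξ ∈ primePowBall K (m - a + n))
    (hn' : ξ ∉ primePowBall K (m - a + n + 1)) {S : Set T} (hSm : MeasurableSet S) (hT : ∀ k ≤ n, ∀ t ∉ S, h (x k) t = h 0 t)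
    (hint : Integrable (fun X : K => (∫ t, ((h X t : ℝ) : ℂ) ^ (-z) ∂ν) * ((ψ (X * ξ) : Circle) : ℂ)) μ)
    (hintk : ∀ k ≤ n, Integrable (fun t => ((h (x k) t : ℝ) : ℂ) ^ (-z)) ν) (hint0 : Integrable (fun t => ((h 0 t : ℝ) : ℂ) ^ (-z)) ν) :
    ∫ X, (∫ t, ((h X t : ℝ) : ℂ) ^ (-z) ∂ν) * ((ψ (X * ξ) : Circle) : ℂ) ∂μ =
      (∫ t in S, ((h 0 t : ℝ) : ℂ) ^ (-z) ∂ν) * (μ.real (primePowBall K a) : ℂ) +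
        (∑ k ∈ Finset.range n, (∫ t in S, ((h (x k) t : ℝ) : ℂ) ^ (-z) ∂ν) *
          ((μ.real (primePowBall K (a - ((k : ℤ) + 1))) : ℂ) - (μ.real (primePowBall K (a - (k : ℤ))) : ℂ))) -
        (∫ t in S, ((h (x n) t : ℝ) : ℂ) ^ (-z) ∂ν) * (μ.real (primePowBall K (a - (n : ℤ))) : ℂ) := by
  have h0 : ∀ X ∈ primePowBall K a, (∫ t, ((h X t : ℝ) : ℂ) ^ (-z) ∂ν) = ∫ t, ((h 0 t : ℝ) : ℂ) ^ (-z) ∂ν := fun X hX =>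
    integral_congr_ae (Eventually.of_forall fun t => congrArg (fun r : ℝ => ((r : ℝ) : ℂ) ^ (-z)) (hB X hX t))
  rw [integral_radialStep_mul_addChar_eq_shellSum μ (Ψ := fun X => ∫ t, ((h X t : ℝ) : ℂ) ^ (-z) ∂ν) h0 (c := fun k => ∫ t, ((h (x k) t : ℝ) : ℂ) ^ (-z) ∂ν) hR hψ hm hn hn' hint]
  have hc0 : ∫ t, ((h 0 t : ℝ) : ℂ) ^ (-z) ∂ν = (∫ t in S, ((h 0 t : ℝ) : ℂ) ^ (-z) ∂ν) + ∫ t in Sᶜ, ((h 0 t : ℝ) : ℂ) ^ (-z) ∂ν :=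
    integral_cpow_neg_eq_setIntegral_add_tail ν hSm (fun _ _ => rfl) hint0
  have hck : ∀ k ≤ n, ∫ t, ((h (x k) t : ℝ) : ℂ) ^ (-z) ∂ν = (∫ t in S, ((h (x k) t : ℝ) : ℂ) ^ (-z) ∂ν) + ∫ t in Sᶜ, ((h 0 t : ℝ) : ℂ) ^ (-z) ∂ν := fun k hk =>
    integral_cpow_neg_eq_setIntegral_add_tail ν hSm (hT k hk) (hintk k hk)
  have hsum : ∑ k ∈ Finset.range n, (∫ t, ((h (x k) t : ℝ) : ℂ) ^ (-z) ∂ν) * ((μ.real (primePowBall K (a - ((k : ℤ) + 1))) : ℂ) - (μ.real (primePowBall K (a - (k : ℤ))) : ℂ)) =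
      ∑ k ∈ Finset.range n, ((∫ t in S, ((h (x k) t : ℝ) : ℂ) ^ (-z) ∂ν) + ∫ t in Sᶜ, ((h 0 t : ℝ) : ℂ) ^ (-z) ∂ν) *
        ((μ.real (primePowBall K (a - ((k : ℤ) + 1))) : ℂ) - (μ.real (primePowBall K (a - (k : ℤ))) : ℂ)) :=
    Finset.sum_congr rfl fun k hk => by rw [hck k (Finset.mem_range.1 hk).le]
  rw [hc0, hsum, hck n le_rfl]
  exact shellSum_add_const μ a _ (fun k => ∫ t in S, ((h (x k) t : ℝ) : ℂ) ^ (-z) ∂ν) _ n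

/-- **HEAD — THE `S`-FACTOR IS ENTIRE.**  For a two-variable kernel `h : K → T → ℝ` with `h ≥ 1`, `h(X,·)` measurable, and the letters (B) base ball on `𝔭^a`, (R) radial shells with
representatives `x_k` (for every exponent), (T) tail off a measurable finite-measure `S` and (H) `h(x_k,·), h(0,·) ≤ H` on `S` for `k ≤ n`: there is ONE ENTIRE `W : ℂ → ℂ` such that for
`ξ ∈ 𝔭^{m−a+n} ∖ 𝔭^{m−a+n+1}` and EVERY `z` at which the iterated integrand is integrable on `K` and the `n+2` shell integrands are integrable on `T` (the consumer's convergence letters,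
e.g. `1 < Re z`),  `∫_K (∫_T h(X,t)^{−z} dν) ψ(Xξ) dμ = W(z)` — `W = S(Φ₀, Φ; n)` with the bounded-`t` integrals `Φ_k(z) = ∫_S h(x_k,t)^{−z} dν` (entire, §5), although no single
shell value `∫_T h(x_k,t)^{−z} dν` is entire.  The N = 3 twin of ★ p858404 `integral_lineSymbol_mul_addChar_eq_shellSum` + `differentiable_lineShellSum`.
[cite: Tate1950, §2.5] [cite: JacquetLanglands1970, §3] [cite: Casselman1980, §3] -/
theorem exists_entire_eq_integral_integral_cpow_neg_mul_addChar {h : K → T → ℝ} (hmeas : ∀ X, Measurable (h X)) (h1 : ∀ X t, 1 ≤ h X t) {a : ℤ}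
    (hB : ∀ X ∈ primePowBall K a, ∀ t, h X t = h 0 t) {x : ℕ → K}
    (hR : ∀ k : ℕ, ∀ X ∈ primePowBall K (a - ((k : ℤ) + 1)) \ primePowBall K (a - (k : ℤ)), ∀ z : ℂ,
      ∫ t, ((h X t : ℝ) : ℂ) ^ (-z) ∂ν = ∫ t, ((h (x k) t : ℝ) : ℂ) ^ (-z) ∂ν)
    {ψ : AddChar K Circle} (hψ : Continuous ψ) {m : ℤ} (hm : ψ.HasConductorExp m) {ξ : K} {n : ℕ} (hn : ξ ∈ primePowBall K (m - a + n))
    (hn' : ξ ∉ primePowBall K (m - a + n + 1)) {S : Set T} (hSm : MeasurableSet S) (hS : ν S ≠ ∞) (hT : ∀ k ≤ n, ∀ t ∉ S, h (x k) t = h 0 t) {H : ℝ}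
    (hH : ∀ k ≤ n, ∀ t ∈ S, h (x k) t ≤ H) (hH0 : ∀ t ∈ S, h 0 t ≤ H) :
    ∃ W : ℂ → ℂ, Differentiable ℂ W ∧ ∀ z : ℂ,
      Integrable (fun X : K => (∫ t, ((h X t : ℝ) : ℂ) ^ (-z) ∂ν) * ((ψ (X * ξ) : Circle) : ℂ)) μ →
      (∀ k ≤ n, Integrable (fun t => ((h (x k) t : ℝ) : ℂ) ^ (-z)) ν) → Integrable (fun t => ((h 0 t : ℝ) : ℂ) ^ (-z)) ν →
        ∫ X, (∫ t, ((h X t : ℝ) : ℂ) ^ (-z) ∂ν) * ((ψ (X * ξ) : Circle) : ℂ) ∂μ = W z := by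
  refine ⟨fun z => (∫ t in S, ((h 0 t : ℝ) : ℂ) ^ (-z) ∂ν) * (μ.real (primePowBall K a) : ℂ) +
      (∑ k ∈ Finset.range n, (∫ t in S, ((h (x k) t : ℝ) : ℂ) ^ (-z) ∂ν) * ((μ.real (primePowBall K (a - ((k : ℤ) + 1))) : ℂ) - (μ.real (primePowBall K (a - (k : ℤ))) : ℂ))) -
      (∫ t in S, ((h (x n) t : ℝ) : ℂ) ^ (-z) ∂ν) * (μ.real (primePowBall K (a - (n : ℤ))) : ℂ), ?_, fun z hint hintk hint0 => ?_⟩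
  · exact differentiable_shellSum μ (differentiable_setIntegral_cpow_neg_of_bounded ν hSm hS (hmeas 0) (fun t _ => h1 0 t) hH0) a
      (fun k hk => differentiable_setIntegral_cpow_neg_of_bounded ν hSm hS (hmeas (x k)) (fun t _ => h1 (x k) t) (hH k hk))
  · exact integral_integral_cpow_neg_mul_addChar_eq_shellSum μ ν hB (fun k X hX => hR k X hX z) hψ hm hn hn' hSm hT hint hintk hint0

/-- **THE SUPPORT OF THE `S`-FACTOR IN THE FREQUENCY** (two-variable form): under the letters (B) and (R), `∫_K (∫_T h(X,t)^{−z} dν) ψ(Xξ) dμ = 0` for `ξ ∉ 𝔭^{m−a}` whenever the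
iterated integrand is integrable — the `ξ`-support is the fractional ideal `𝔭^{m−a}` (the `Cf`-box input of W4₃ via ★ `K2E1FractionalIdealAdelicSupport`). [cite: Tate1950, §2.5] -/
theorem integral_integral_cpow_neg_mul_addChar_eq_zero_of_not_mem {h : K → T → ℝ} {a : ℤ} (hB : ∀ X ∈ primePowBall K a, ∀ t, h X t = h 0 t) {x : ℕ → K} {z : ℂ}
    (hR : ∀ k : ℕ, ∀ X ∈ primePowBall K (a - ((k : ℤ) + 1)) \ primePowBall K (a - (k : ℤ)),
      ∫ t, ((h X t : ℝ) : ℂ) ^ (-z) ∂ν = ∫ t, ((h (x k) t : ℝ) : ℂ) ^ (-z) ∂ν)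
    {ψ : AddChar K Circle} (hψ : Continuous ψ) {m : ℤ} (hm : ψ.HasConductorExp m) {ξ : K} (hξ : ξ ∉ primePowBall K (m - a))
    (hint : Integrable (fun X : K => (∫ t, ((h X t : ℝ) : ℂ) ^ (-z) ∂ν) * ((ψ (X * ξ) : Circle) : ℂ)) μ) :
    ∫ X, (∫ t, ((h X t : ℝ) : ℂ) ^ (-z) ∂ν) * ((ψ (X * ξ) : Circle) : ℂ) ∂μ = 0 :=
  integral_radialStep_mul_addChar_eq_zero_of_not_mem μ (Ψ := fun X => ∫ t, ((h X t : ℝ) : ℂ) ^ (-z) ∂ν)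
    (fun X hX => integral_congr_ae (Eventually.of_forall fun t => congrArg (fun r : ℝ => ((r : ℝ) : ℂ) ^ (-z)) (hB X hX t)))
    (c := fun k => ∫ t, ((h (x k) t : ℝ) : ℂ) ^ (-z) ∂ν) hR hψ hm hξ hint

end TwoVariable

end Summit.HodgeConjecture.HodgeConjecture.Cruxes.H413.K2E1FiniteWhittakerStepSymbolU3Tail

end
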